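import Literature.Analysis.FluidPDE.Wei2016SwirlCriterionProofs
import HarnessLib

/-!
# Wei 2016, proof of Theorem 1.1: "(b) implies condition (a)'" — the constants bookkeeping

Analysis/FluidPDE proof file (theorems only) on the way to
`Literature.Analysis.FluidPDE.Wei2016_logModulus_regularity`
(`LeiZhang2017AxisymmetricCriteria.lean`), continuing `Wei2016SwirlCriterionProofs.lean`, after

* D. Wei, *Regularity criterion to the axially symmetric Navier–Stokes equations*, J. Math. Anal.
  Appl. 435 (2016) 402–413 = arXiv:1508.03318, §3, end of the proof of Thm. 1.1: "Now we claim
  that, if `C₀ > C_* max{1, √(C₁/3)}`, then (b) implies condition (a)'. Here `C₁`, `C_*` are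
  absolute positive constants."

With `A(t) = ‖J‖² + ε^{2/3}‖Ω‖²/2`, `M₂ = 1 + ε^{1/3}‖Γ‖_∞ + ε^{-2/3}‖Γ‖²_∞`,
`M₁ = (1 + ‖Γ₀‖_∞)‖u₀‖₂`, `M₀ = (‖J₀‖₂ + ‖Ω₀‖₂) M₁³`, condition (a)' reads
`F(A(0)) > C₁ M₂ ‖u₀‖²` for Wei's `F(y) = ∫_y^∞ [max{y^{4/3}/(εK(ε))^{8/3}, r₀^{-4}}]^{-1} dy`
(`Wei2016.F`), and the printed chain is

> `F(A(0)) ≥ F(max{A(0), (εK)²/r₀³}) = 3 max{…}^{-1/3} (εK)^{8/3}`,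
> `A(0)^{1/2} ≤ ‖J₀‖ + ‖Ω₀‖`, `M₂ < ε^{-2/3}(1 + ‖Γ‖_∞)²`, `M₂‖u₀‖² ≤ ε^{-2/3} M₁²`,
> `A(0)^{1/2} M₁³ ≤ M₀`, (b) implies `K₀(ε) > C₀ max{M₀^{1/4}, r₀^{-1/2} M₁}`, hence
> `(M₂‖u₀‖²/F(A(0)))^{3/2} ≤ … < 3^{-3/2} (C_*/C₀)³ ≤ C₁^{-3/2}` and `F(A(0)) > C₁ M₂ ‖u₀‖²`.

This file proves the claim as a statement about real numbers
(`Wei2016.F_gt_of_threshold`), run with integer powers (cubing `3κ m^{-1/3} > C₁M₂‖u₀‖²` and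
splitting `m = max{A(0), (εK)²/r₀³}`) instead of the printed `3/2`-powers; the two uses of
`ε^{4/3}K(ε) ≥ K₀(ε)/C_*` become `ε²(εK)⁸ ≥ (K₀/C_*)⁸` and `ε²(εK)⁶ = (ε^{4/3}K)⁶ ≥ (K₀/C_*)⁶`,
and the printed hypothesis `C₀ > C_* max{1, √(C₁/3)}` is used in the (weaker, non-strict) form
`C₀ ≥ C_* max{1, √(C₁/3)}`, which gives `27 C₀⁸ ≥ C₁³ C_*⁸` and `27 C₀⁶ ≥ C₁³ C_*⁶`. The inputs
`A(0) ≤ (‖J₀‖ + ‖Ω₀‖)²`, `M₂ ≤ ε^{-2/3}(1 + ‖Γ₀‖_∞)²` (`Wei2016.M₂_le`, from `‖Γ‖_∞ ≤ ‖Γ₀‖_∞`,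
(1.4)) and `K₀ ≤ C_* ε^{4/3} K` (`Wei2016.K₀_le_exp_three_mul`, `C_* = e³`) enter as hypotheses on
abstract reals, so that the lemma applies verbatim once the PDE estimates fix the constants.

## References

* D. Wei, J. Math. Anal. Appl. 435 (2016) 402–413, arXiv:1508.03318, §3, proof of Thm. 1.1
  (the claim "(b) implies (a)'", last page but one). [Wei2016]
-/

noncomputable section

open Set

namespace Literature.Analysis.FluidPDE

namespace Wei2016

/-! ### Small `rpow` conversions -/

/-- `(x^{4/3})⁶ = x⁸` for `x ≥ 0`. [folklore] -/
theorem rpow_four_thirds_pow_six {x : ℝ} (hx : 0 ≤ x) : (x ^ (4 / 3 : ℝ)) ^ 6 = x ^ 8 := by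
  rw [← Real.rpow_natCast, ← Real.rpow_mul hx]
  norm_num

/-- `(x^{4/3})⁸ ≤ x¹⁰` for `0 ≤ x ≤ 1` (`= x^{32/3} = x¹⁰ x^{2/3}`). [folklore] -/
theorem rpow_four_thirds_pow_eight_le {x : ℝ} (hx : 0 ≤ x) (hx1 : x ≤ 1) :
    (x ^ (4 / 3 : ℝ)) ^ 8 ≤ x ^ 10 := by
  have h1 : (x ^ (4 / 3 : ℝ)) ^ 8 = x ^ (32 / 3 : ℝ) := by
    rw [← Real.rpow_natCast, ← Real.rpow_mul hx]
    norm_num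
  have h2 : (x ^ 10 : ℝ) = x ^ (10 : ℝ) := by
    rw [← Real.rpow_natCast x 10]
    norm_num
  rw [h1, h2]
  exact Real.rpow_le_rpow_of_exponent_ge' hx hx1 (by norm_num) (by norm_num)

/-- `(x^{1/4})⁸ = x²` for `x ≥ 0`. [folklore] -/
theorem rpow_quarter_pow_eight {x : ℝ} (hx : 0 ≤ x) : (x ^ (1 / 4 : ℝ)) ^ 8 = x ^ 2 := by
  rw [← Real.rpow_natCast, ← Real.rpow_mul hx]
  norm_num

/-- `(x^{-1/2})⁶ = (x³)⁻¹` for `x > 0`. [folklore] -/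
theorem rpow_neg_half_pow_six {x : ℝ} (hx : 0 < x) : (x ^ (-(1 / 2 : ℝ))) ^ 6 = (x ^ 3)⁻¹ := by
  rw [← Real.rpow_natCast, ← Real.rpow_mul hx.le, ← Real.rpow_natCast x 3, ← Real.rpow_neg hx.le]
  norm_num

/-- `(x^{8/3})³ = x⁸` for `x ≥ 0` (the cube of `κ = (εK)^{8/3}`). [folklore] -/
theorem rpow_eight_thirds_pow_three {x : ℝ} (hx : 0 ≤ x) : (x ^ (8 / 3 : ℝ)) ^ 3 = x ^ 8 := by
  rw [← Real.rpow_natCast, ← Real.rpow_mul hx]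
  norm_num

/-- `(ε^{-2/3})³ = (ε²)⁻¹` for `ε > 0`. [folklore] -/
theorem rpow_neg_two_thirds_pow_three {ε : ℝ} (hε : 0 < ε) :
    (ε ^ (-(2 / 3 : ℝ))) ^ 3 = (ε ^ 2)⁻¹ := by
  rw [← Real.rpow_natCast, ← Real.rpow_mul hε.le, ← Real.rpow_natCast ε 2, ← Real.rpow_neg hε.le]
  norm_num

/-- The junction of Wei's `F` for `κ = x^{8/3}` (`x = εK`), `ρ = r₀^{-4}`:
`y₀ = (κρ)^{3/4} = x²/r₀³`. [cite: Wei2016, proof of Thm. 1.1 (F(max{A(0), (εK)²/r₀³}))] -/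
theorem yJ_eq {x r₀ : ℝ} (hx : 0 ≤ x) (hr₀ : 0 < r₀) :
    yJ (x ^ (8 / 3 : ℝ)) ((r₀ ^ 4)⁻¹) = x ^ 2 * (r₀ ^ 3)⁻¹ := by
  have h1 : (x ^ (8 / 3 : ℝ)) ^ (3 / 4 : ℝ) = x ^ 2 := by
    rw [← Real.rpow_mul hx]
    norm_num
  have h2 : ((r₀ ^ 4)⁻¹) ^ (3 / 4 : ℝ) = (r₀ ^ 3)⁻¹ := by
    rw [Real.inv_rpow (pow_nonneg hr₀.le 4), ← Real.rpow_natCast r₀ 4, ← Real.rpow_mul hr₀.le,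
      ← Real.rpow_natCast r₀ 3]
    norm_num
  rw [yJ, Real.mul_rpow (Real.rpow_nonneg hx _) (inv_nonneg.2 (pow_nonneg hr₀.le 4)), h1, h2]

/-! ### `M₂ < ε^{-2/3}(1 + ‖Γ‖_∞)²` -/

/-- **"`M₂ < ε^{-2/3}(1 + ‖Γ‖_{L^∞})²`"** in the non-strict form:
`1 + ε^{1/3}Γ + ε^{-2/3}Γ² ≤ ε^{-2/3}(1 + Γ)²` for `0 < ε ≤ 1`, `Γ ≥ 0` (the difference is
`(ε^{-2/3} − 1) + (2ε^{-2/3} − ε^{1/3})Γ ≥ 0`). [cite: Wei2016, proof of Thm. 1.1 ("from the definition of M₂, M₁, M₀ and (1.4)")] -/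
theorem M₂_le {ε Γ : ℝ} (hε : 0 < ε) (hε1 : ε ≤ 1) (hΓ : 0 ≤ Γ) :
    1 + ε ^ (1 / 3 : ℝ) * Γ + ε ^ (-(2 / 3 : ℝ)) * Γ ^ 2 ≤ ε ^ (-(2 / 3 : ℝ)) * (1 + Γ) ^ 2 := by
  have h1 : ε ^ (1 / 3 : ℝ) ≤ 1 := Real.rpow_le_one hε.le hε1 (by norm_num)
  have h2 : 1 ≤ ε ^ (-(2 / 3 : ℝ)) :=
    Real.one_le_rpow_of_pos_of_le_one_of_nonpos hε hε1 (by norm_num)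
  have key : ε ^ (-(2 / 3 : ℝ)) * (1 + Γ) ^ 2 -
      (1 + ε ^ (1 / 3 : ℝ) * Γ + ε ^ (-(2 / 3 : ℝ)) * Γ ^ 2) =
      (ε ^ (-(2 / 3 : ℝ)) - 1) + (2 * ε ^ (-(2 / 3 : ℝ)) - ε ^ (1 / 3 : ℝ)) * Γ := by
    ring
  have hpos : 0 ≤ (ε ^ (-(2 / 3 : ℝ)) - 1) + (2 * ε ^ (-(2 / 3 : ℝ)) - ε ^ (1 / 3 : ℝ)) * Γ :=
    add_nonneg (sub_nonneg.2 h2) (mul_nonneg (by linarith) hΓ)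
  linarith

/-! ### The claim "(b) implies (a)'" -/

/-- The arithmetic pattern used twice below: from `a q ≤ 27 b`, `b d < k`, `k ≤ q c` with
`q > 0`, `d ≥ 0`, conclude `a d < 27 c`. [folklore] -/
theorem mul_lt_of_chain {a b c d k q : ℝ} (hq : 0 < q) (hd : 0 ≤ d) (h1 : a * q ≤ 27 * b)
    (h2 : b * d < k) (h3 : k ≤ q * c) : a * d < 27 * c := by
  have h4 : a * d * q ≤ 27 * b * d := by nlinarith
  have h5 : a * d * q < 27 * (q * c) := by linarith
  have h6 : a * d * q < 27 * c * q := by linarith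
  exact lt_of_mul_lt_mul_right h6 hq.le

/-- **Wei 2016, proof of Thm. 1.1: "if `C₀ > C_* max{1, √(C₁/3)}`, then (b) implies condition
(a)'"**, as a statement about real numbers. Data: `0 < ε ≤ 1`, `K > 0`, `K₀ ≥ 0` with
`K₀ ≤ C_* ε^{4/3} K` (Wei's `K(ε)`, `K₀(ε)`, `C_*`); the energy constant `C₁ > 0`; the threshold
constant `C₀ ≥ C_* max{1, √(C₁/3)}`; `r₀ > 0`; `E₀ = ‖u₀‖₂ ≥ 0`, `N₀ = ‖J₀‖₂ + ‖Ω₀‖₂ ≥ 0`,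
`Γ₀ = ‖Γ₀‖_∞ ≥ 0`, so that `M₁ = (1 + Γ₀)E₀`, `M₀ = N₀ M₁³`; `A₀ = A(0)` with
`0 ≤ A₀ ≤ N₀²`; `0 ≤ M₂ ≤ ε^{-2/3}(1 + Γ₀)²`; and the smallness
`C₀ max{M₀^{1/4}, r₀^{-1/2} M₁} < K₀` (which is what (a)/(b) give through
`K₀(ε) = C₀ max{…} + 1` for the `ε` of (3.4)). Conclusion: condition (a)',
`C₁ M₂ ‖u₀‖² < F(A(0))` for `F = Wei2016.F κ ρ`, `κ = (εK)^{8/3}`, `ρ = r₀^{-4}`. The proof runs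
the printed chain with integer powers: `F(A₀) ≥ F(max{A₀, y₀}) = 3κ m^{-1/3}`, and
`3κ m^{-1/3} > X = C₁M₂E₀²` because `X³ m < 27κ³ = 27(εK)⁸`, which for `m = A₀` follows from
`X³ ≤ C₁³ε⁻²M₁⁶`, `M₁⁶A₀ ≤ M₀²`, `27C₀⁸ ≥ C₁³C_*⁸`, `C₀⁸M₀² < K₀⁸ ≤ C_*⁸ε²(εK)⁸`, and for
`m = y₀ = (εK)²/r₀³` from `27C₀⁶ ≥ C₁³C_*⁶`, `C₀⁶M₁⁶/r₀³ < K₀⁶ ≤ C_*⁶ε²(εK)⁶`.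
[cite: Wei2016, proof of Thm. 1.1 (the claim "(b) implies (a)'")] -/
theorem F_gt_of_threshold {ε K K₀ Cs C₀ C₁ r₀ E₀ N₀ Γ₀ A₀ M₂ : ℝ} (hε : 0 < ε) (hε1 : ε ≤ 1)
    (hK : 0 < K) (hK₀ : 0 ≤ K₀) (hCs : 0 < Cs) (hKK₀ : K₀ ≤ Cs * (ε ^ (4 / 3 : ℝ) * K))
    (hC₁ : 0 < C₁) (hC₀ : Cs * max 1 (Real.sqrt (C₁ / 3)) ≤ C₀) (hr₀ : 0 < r₀) (hE₀ : 0 ≤ E₀)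
    (hN₀ : 0 ≤ N₀) (hΓ₀ : 0 ≤ Γ₀) (hA₀ : 0 ≤ A₀) (hA₀N : A₀ ≤ N₀ ^ 2) (hM₂0 : 0 ≤ M₂)
    (hM₂ : M₂ ≤ ε ^ (-(2 / 3 : ℝ)) * (1 + Γ₀) ^ 2)
    (hb : C₀ * max ((N₀ * ((1 + Γ₀) * E₀) ^ 3) ^ (1 / 4 : ℝ))
      (r₀ ^ (-(1 / 2 : ℝ)) * ((1 + Γ₀) * E₀)) < K₀) :
    C₁ * M₂ * E₀ ^ 2 < F ((ε * K) ^ (8 / 3 : ℝ)) ((r₀ ^ 4)⁻¹) A₀ := by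
  -- names
  set M₁ : ℝ := (1 + Γ₀) * E₀ with hM₁
  set M₀ : ℝ := N₀ * M₁ ^ 3 with hM₀
  set κ : ℝ := (ε * K) ^ (8 / 3 : ℝ) with hκ
  set ρ : ℝ := (r₀ ^ 4)⁻¹ with hρ
  set X : ℝ := C₁ * M₂ * E₀ ^ 2 with hX
  have hεK : 0 < ε * K := mul_pos hε hK
  have hκ0 : 0 < κ := Real.rpow_pos_of_pos hεK _
  have hρ0 : 0 < ρ := inv_pos.2 (pow_pos hr₀ 4)
  have hM₁0 : 0 ≤ M₁ := by positivity
  have hM₀0 : 0 ≤ M₀ := by positivity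
  have hX0 : 0 ≤ X := by positivity
  have hC₀0 : 0 < C₀ := lt_of_lt_of_le (by positivity) hC₀
  have hε2 : 0 < ε ^ 2 := pow_pos hε 2
  have hr3 : 0 < r₀ ^ 3 := pow_pos hr₀ 3
  -- the junction `y₀ = (εK)²/r₀³` and `m = max(A₀, y₀)`
  have hyJ : yJ κ ρ = (ε * K) ^ 2 * (r₀ ^ 3)⁻¹ := yJ_eq hεK.le hr₀
  set m : ℝ := max A₀ (yJ κ ρ) with hm
  have hy₀0 : 0 < yJ κ ρ := yJ_pos hκ0 hρ0
  have hm0 : 0 < m := lt_max_of_lt_right hy₀0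
  -- `F(A₀) ≥ F(m) = 3κ m^{-1/3}` (F non-increasing on `[0, ∞)`)
  have hFanti : F κ ρ m ≤ F κ ρ A₀ := by
    have hanti : AntitoneOn (F κ ρ) (Ici 0) := by
      refine antitoneOn_of_deriv_nonpos (convex_Ici 0) (continuous_F hκ0 hρ0).continuousOn
        (fun y _ => (hasDerivAt_F hκ0 hρ0 y).differentiableAt.differentiableWithinAt) ?_
      intro y hy
      rw [interior_Ici] at hy
      rw [(hasDerivAt_F hκ0 hρ0 y).deriv]
      exact dF_nonpos hκ0 hρ0 (le_of_lt hy)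
    exact hanti (show (A₀ : ℝ) ∈ Ici 0 from hA₀) (show m ∈ Ici 0 from hm0.le) (le_max_left _ _)
  have hFm : F κ ρ m = 3 * κ * m ^ (-(1 / 3 : ℝ)) := F_of_le (le_max_right _ _)
  have hκ3 : κ ^ 3 = (ε * K) ^ 8 := rpow_eight_thirds_pow_three hεK.le
  -- it suffices to prove `X³ m < 27 κ³`
  suffices hmain : X ^ 3 * m < 27 * (ε * K) ^ 8 by
    refine lt_of_lt_of_le ?_ hFanti
    rw [hFm]
    set t : ℝ := m ^ (1 / 3 : ℝ) with ht
    have ht0 : 0 < t := Real.rpow_pos_of_pos hm0 _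
    have ht3 : t ^ 3 = m := by
      rw [ht, ← Real.rpow_natCast, ← Real.rpow_mul hm0.le]
      norm_num
    have htinv : m ^ (-(1 / 3 : ℝ)) = t⁻¹ := by
      rw [ht, Real.rpow_neg hm0.le]
    rw [htinv, show 3 * κ * t⁻¹ = 3 * κ / t by ring, lt_div_iff₀ ht0]
    by_contra hle
    push Not at hle
    have h1 : (3 * κ) ^ 3 ≤ (X * t) ^ 3 := pow_le_pow_left₀ (by positivity) hle 3
    have h2 : (X * t) ^ 3 = X ^ 3 * m := by rw [mul_pow, ht3]
    have h3 : (3 * κ) ^ 3 = 27 * (ε * K) ^ 8 := by rw [mul_pow, hκ3]; norm_num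
    linarith
  -- `X³ ≤ C₁³ ε⁻² M₁⁶`
  have hXle : X ≤ C₁ * (ε ^ (-(2 / 3 : ℝ)) * M₁ ^ 2) := by
    have h1 : M₂ * E₀ ^ 2 ≤ ε ^ (-(2 / 3 : ℝ)) * (1 + Γ₀) ^ 2 * E₀ ^ 2 :=
      mul_le_mul_of_nonneg_right hM₂ (sq_nonneg _)
    calc X = C₁ * (M₂ * E₀ ^ 2) := by rw [hX]; ring
      _ ≤ C₁ * (ε ^ (-(2 / 3 : ℝ)) * (1 + Γ₀) ^ 2 * E₀ ^ 2) := mul_le_mul_of_nonneg_left h1 hC₁.le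
      _ = C₁ * (ε ^ (-(2 / 3 : ℝ)) * M₁ ^ 2) := by rw [hM₁]; ring
  have hX3 : X ^ 3 ≤ C₁ ^ 3 * (ε ^ 2)⁻¹ * M₁ ^ 6 := by
    calc X ^ 3 ≤ (C₁ * (ε ^ (-(2 / 3 : ℝ)) * M₁ ^ 2)) ^ 3 := pow_le_pow_left₀ hX0 hXle 3
      _ = C₁ ^ 3 * (ε ^ (-(2 / 3 : ℝ))) ^ 3 * M₁ ^ 6 := by ring
      _ = C₁ ^ 3 * (ε ^ 2)⁻¹ * M₁ ^ 6 := by rw [rpow_neg_two_thirds_pow_three hε]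
  -- the two consequences of `K₀ ≤ C_* ε^{4/3} K`
  have hq0 : 0 ≤ K₀ / Cs := div_nonneg hK₀ hCs.le
  have hq : K₀ / Cs ≤ ε ^ (4 / 3 : ℝ) * K := by
    rw [div_le_iff₀ hCs]
    linarith [mul_comm Cs (ε ^ (4 / 3 : ℝ) * K)]
  have hpow8 : K₀ ^ 8 ≤ Cs ^ 8 * (ε ^ 2 * (ε * K) ^ 8) := by
    have h : (K₀ / Cs) ^ 8 ≤ ε ^ 2 * (ε * K) ^ 8 := by
      calc (K₀ / Cs) ^ 8 ≤ (ε ^ (4 / 3 : ℝ) * K) ^ 8 := pow_le_pow_left₀ hq0 hq 8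
        _ = (ε ^ (4 / 3 : ℝ)) ^ 8 * K ^ 8 := mul_pow _ _ _
        _ ≤ ε ^ 10 * K ^ 8 :=
            mul_le_mul_of_nonneg_right (rpow_four_thirds_pow_eight_le hε.le hε1) (pow_nonneg hK.le 8)
        _ = ε ^ 2 * (ε * K) ^ 8 := by ring
    rw [div_pow, div_le_iff₀ (pow_pos hCs 8)] at h
    linarith
  have hpow6 : K₀ ^ 6 ≤ Cs ^ 6 * (ε ^ 2 * (ε * K) ^ 6) := by
    have h : (K₀ / Cs) ^ 6 ≤ ε ^ 2 * (ε * K) ^ 6 := by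
      calc (K₀ / Cs) ^ 6 ≤ (ε ^ (4 / 3 : ℝ) * K) ^ 6 := pow_le_pow_left₀ hq0 hq 6
        _ = (ε ^ (4 / 3 : ℝ)) ^ 6 * K ^ 6 := mul_pow _ _ _
        _ = ε ^ 8 * K ^ 6 := by rw [rpow_four_thirds_pow_six hε.le]
        _ = ε ^ 2 * (ε * K) ^ 6 := by ring
    rw [div_pow, div_le_iff₀ (pow_pos hCs 6)] at h
    linarith
  -- the two consequences of the threshold `C₀ max{M₀^{1/4}, r₀^{-1/2} M₁} < K₀`
  have hb1 : C₀ * M₀ ^ (1 / 4 : ℝ) < K₀ :=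
    lt_of_le_of_lt (mul_le_mul_of_nonneg_left (le_max_left _ _) hC₀0.le) hb
  have hb2 : C₀ * (r₀ ^ (-(1 / 2 : ℝ)) * M₁) < K₀ :=
    lt_of_le_of_lt (mul_le_mul_of_nonneg_left (le_max_right _ _) hC₀0.le) hb
  have hK₀8 : 0 < M₀ → C₀ ^ 8 * M₀ ^ 2 < K₀ ^ 8 := fun hM₀pos => by
    have h := pow_lt_pow_left₀ hb1 (by positivity) (by norm_num : (8 : ℕ) ≠ 0)
    rwa [mul_pow, rpow_quarter_pow_eight hM₀0] at h
  have hK₀6 : 0 < M₁ → C₀ ^ 6 * (M₁ ^ 6 * (r₀ ^ 3)⁻¹) < K₀ ^ 6 := fun hM₁pos => by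
    have h := pow_lt_pow_left₀ hb2 (by positivity) (by norm_num : (6 : ℕ) ≠ 0)
    rw [mul_pow, mul_pow, rpow_neg_half_pow_six hr₀] at h
    linarith [h]
  -- the two consequences of `C₀ ≥ C_* max{1, √(C₁/3)}`: `C₁³ C_*⁸ ≤ 27 C₀⁸`, `C₁³ C_*⁶ ≤ 27 C₀⁶`
  have hsq : Real.sqrt (C₁ / 3) ^ 2 = C₁ / 3 := Real.sq_sqrt (by positivity)
  have hC₀1 : Cs ≤ C₀ := by
    have h := mul_le_mul_of_nonneg_left (le_max_left (1 : ℝ) (Real.sqrt (C₁ / 3))) hCs.le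
    rw [mul_one] at h
    exact h.trans hC₀
  have hC₀2 : Cs * Real.sqrt (C₁ / 3) ≤ C₀ :=
    le_trans (mul_le_mul_of_nonneg_left (le_max_right _ _) hCs.le) hC₀
  have h6 : C₁ ^ 3 * Cs ^ 6 ≤ 27 * C₀ ^ 6 := by
    have h := pow_le_pow_left₀ (by positivity) hC₀2 6
    rw [mul_pow, show Real.sqrt (C₁ / 3) ^ 6 = (Real.sqrt (C₁ / 3) ^ 2) ^ 3 by ring, hsq] at h
    have e : Cs ^ 6 * (C₁ / 3) ^ 3 = C₁ ^ 3 * Cs ^ 6 / 27 := by ring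
    rw [e, div_le_iff₀ (by norm_num : (0 : ℝ) < 27)] at h
    linarith
  have h8 : C₁ ^ 3 * Cs ^ 8 ≤ 27 * C₀ ^ 8 := by
    have hCs8 : 0 ≤ Cs ^ 8 := pow_nonneg hCs.le 8
    by_cases hc : C₁ / 3 ≤ 1
    · have h := pow_le_pow_left₀ hCs.le hC₀1 8
      have hc3 : (C₁ / 3) ^ 3 ≤ 1 := pow_le_one₀ (by positivity) hc
      have e : C₁ ^ 3 * Cs ^ 8 = 27 * (Cs ^ 8 * (C₁ / 3) ^ 3) := by ring
      rw [e]
      have : Cs ^ 8 * (C₁ / 3) ^ 3 ≤ Cs ^ 8 * 1 := mul_le_mul_of_nonneg_left hc3 hCs8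
      linarith
    · push Not at hc
      have h := pow_le_pow_left₀ (by positivity) hC₀2 8
      rw [mul_pow, show Real.sqrt (C₁ / 3) ^ 8 = (Real.sqrt (C₁ / 3) ^ 2) ^ 4 by ring, hsq] at h
      have hc4 : (C₁ / 3) ^ 3 ≤ (C₁ / 3) ^ 4 := pow_le_pow_right₀ hc.le (by norm_num)
      have e : C₁ ^ 3 * Cs ^ 8 = 27 * (Cs ^ 8 * (C₁ / 3) ^ 3) := by ring
      rw [e]
      have : Cs ^ 8 * (C₁ / 3) ^ 3 ≤ Cs ^ 8 * (C₁ / 3) ^ 4 := mul_le_mul_of_nonneg_left hc4 hCs8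
      linarith
  -- conclusion, according to which term realises the max
  rcases le_total A₀ (yJ κ ρ) with hAy | hyA
  · -- `m = y₀ = (εK)²/r₀³`
    rw [hm, max_eq_right hAy, hyJ]
    rcases hM₁0.eq_or_lt with hM₁z | hM₁pos
    · -- `M₁ = 0`: then `X = 0`
      have hX0' : X = 0 := by
        refine le_antisymm ?_ hX0
        calc X ≤ C₁ * (ε ^ (-(2 / 3 : ℝ)) * M₁ ^ 2) := hXle
          _ = 0 := by rw [← hM₁z]; ring
      rw [hX0']
      have : (0 : ℝ) ^ 3 * ((ε * K) ^ 2 * (r₀ ^ 3)⁻¹) = 0 := by ring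
      rw [this]
      positivity
    · -- `T = C₁³ M₁⁶/r₀³ < 27 ε²(εK)⁶`
      have hT : C₁ ^ 3 * (M₁ ^ 6 * (r₀ ^ 3)⁻¹) < 27 * (ε ^ 2 * (ε * K) ^ 6) :=
        mul_lt_of_chain (pow_pos hCs 6) (by positivity) h6 (hK₀6 hM₁pos) hpow6
      have hεK2 : 0 < (ε * K) ^ 2 := pow_pos hεK 2
      calc X ^ 3 * ((ε * K) ^ 2 * (r₀ ^ 3)⁻¹)
          ≤ C₁ ^ 3 * (ε ^ 2)⁻¹ * M₁ ^ 6 * ((ε * K) ^ 2 * (r₀ ^ 3)⁻¹) :=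
            mul_le_mul_of_nonneg_right hX3 (by positivity)
        _ = (ε ^ 2)⁻¹ * (ε * K) ^ 2 * (C₁ ^ 3 * (M₁ ^ 6 * (r₀ ^ 3)⁻¹)) := by ring
        _ < (ε ^ 2)⁻¹ * (ε * K) ^ 2 * (27 * (ε ^ 2 * (ε * K) ^ 6)) :=
            mul_lt_mul_of_pos_left hT (by positivity)
        _ = 27 * (ε * K) ^ 8 := by
            field_simp
  · -- `m = A₀`
    rw [hm, max_eq_left hyA]
    have hM₁6A : M₁ ^ 6 * A₀ ≤ M₀ ^ 2 := by
      calc M₁ ^ 6 * A₀ ≤ M₁ ^ 6 * N₀ ^ 2 := mul_le_mul_of_nonneg_left hA₀N (pow_nonneg hM₁0 6)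
        _ = M₀ ^ 2 := by rw [hM₀]; ring
    have h1 : X ^ 3 * A₀ ≤ (ε ^ 2)⁻¹ * (C₁ ^ 3 * M₀ ^ 2) := by
      calc X ^ 3 * A₀ ≤ C₁ ^ 3 * (ε ^ 2)⁻¹ * M₁ ^ 6 * A₀ := mul_le_mul_of_nonneg_right hX3 hA₀
        _ = (ε ^ 2)⁻¹ * C₁ ^ 3 * (M₁ ^ 6 * A₀) := by ring
        _ ≤ (ε ^ 2)⁻¹ * C₁ ^ 3 * M₀ ^ 2 := mul_le_mul_of_nonneg_left hM₁6A (by positivity)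
        _ = (ε ^ 2)⁻¹ * (C₁ ^ 3 * M₀ ^ 2) := by ring
    rcases hM₀0.eq_or_lt with hM₀z | hM₀pos
    · -- `M₀ = 0`: then `X³ A₀ = 0`
      have hzero : X ^ 3 * A₀ ≤ 0 := by
        calc X ^ 3 * A₀ ≤ (ε ^ 2)⁻¹ * (C₁ ^ 3 * M₀ ^ 2) := h1
          _ = 0 := by rw [← hM₀z]; ring
      exact lt_of_le_of_lt hzero (by positivity)
    · have hS : C₁ ^ 3 * M₀ ^ 2 < 27 * (ε ^ 2 * (ε * K) ^ 8) :=
        mul_lt_of_chain (pow_pos hCs 8) (by positivity) h8 (hK₀8 hM₀pos) hpow8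
      calc X ^ 3 * A₀ ≤ (ε ^ 2)⁻¹ * (C₁ ^ 3 * M₀ ^ 2) := h1
        _ < (ε ^ 2)⁻¹ * (27 * (ε ^ 2 * (ε * K) ^ 8)) := mul_lt_mul_of_pos_left hS (by positivity)
        _ = 27 * (ε * K) ^ 8 := by
            field_simp


end Wei2016

end Literature.Analysis.FluidPDE

end
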